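import Summits.CriticalPhenomena.PercolationContinuityZ3.Theorems.PercNearOneGluingNoHeavyLowerTailSahiCombTriWAndLattice3

/-!
# AND with the block `orCherry` ⊆ `2^(Fin 4)` = `x₀ ∨ x₁(x₂ ∨ x₃)`, part 1: the family, the rows and the row defect

`orCherry` = {{0}, {0, 1}, {0, 2}, {1, 2}, {0, 1, 2}, {0, 3}, {1, 3}, {0, 1, 3}, {0, 2, 3}, {1, 2, 3}, univ}.

Support file of the one-cut programme (crux `NoHeavyLowerTail`, stmt-CriticalPhenomena-4575; unit `prim-lf-1` gen 47, memo
`FROM-prim-lf-1-gen47-JOINT-RECIPES.md`).  Same template as `…SahiCombTriWAndOrOrAndRows`: the row defect `rowLow_orCherry` of the sectionwise Formula-A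
score on `andProd P₁ orCherry` and its row decomposition `scoreVal_sub_lForm_andProd_orCherry`.  `S_Q` has 6 elements, `E_Q` has 5.
HONEST LABEL: complete proofs, std axioms; bookkeeping only. [this work]
-/

namespace Summit.CriticalPhenomena.PercolationContinuityZ3.Theorems

namespace FiveUpSet

open Finset

variable {β γ₁ : Type} [DecidableEq β] [Fintype β] [DecidableEq γ₁] [Fintype γ₁]

/-! ### The family `orCherry` -/

/-- The block `orCherry` (given by its 11 elements). [this work] -/
def orCherry : Finset (Finset (Fin 4)) := {{0}, {0, 1}, {0, 2}, {1, 2}, {0, 1, 2}, {0, 3}, {1, 3}, {0, 1, 3}, {0, 2, 3}, {1, 2, 3}, univ}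

/-- `orCherry` is an up-set. [this work] -/
theorem isUpperSet_orCherry : IsUpperSet (orCherry : Set (Finset (Fin 4))) := by
  intro y y' hyy' hy
  have key : ∀ a ∈ orCherry, ∀ b : Finset (Fin 4), a ⊆ b → b ∈ orCherry := by decide
  exact key y hy y' hyy'

/-- The symmetric core `orCherry ∩ refl orCherry`. [this work] -/
theorem orCherry_inter_refl : orCherry ∩ refl orCherry = {{0}, {0, 2}, {1, 2}, {0, 3}, {1, 3}, {1, 2, 3}} := by decide

/-- The asymmetric part of `orCherry`. [this work] -/
theorem orCherry_sdiff_refl : orCherry \ refl orCherry = {{0, 1}, {0, 1, 2}, {0, 1, 3}, {0, 2, 3}, univ} := by decide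

/-- `refl orCherry`. [this work] -/
theorem refl_orCherry : refl orCherry = {∅, {0}, {1}, {2}, {0, 2}, {1, 2}, {3}, {0, 3}, {1, 3}, {2, 3}, {1, 2, 3}} := by decide

/-! ### The row defect and its decomposition -/

/-- The row defect of the sectionwise Formula-A score on `P₁ ∧ orCherry` (per `x`). [this work] -/
def rowLow_orCherry (A B : Finset (Finset (γ₁ ⊕ Fin 4))) (x : Finset γ₁) : ℤ :=
    (ind A (x.disjSum {0, 1}) - ind A (xᶜ.disjSum {2, 3})) * (ind B (x.disjSum {0, 1}) - ind B (xᶜ.disjSum {2, 3}))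
    + (ind A (x.disjSum {0, 1, 2}) - ind A (xᶜ.disjSum {3})) * (ind B (x.disjSum {0, 1, 2}) - ind B (xᶜ.disjSum {3}))
    + (ind A (x.disjSum {0, 1, 3}) - ind A (xᶜ.disjSum {2})) * (ind B (x.disjSum {0, 1, 3}) - ind B (xᶜ.disjSum {2}))
    + (ind A (x.disjSum {0, 2, 3}) - ind A (xᶜ.disjSum {1})) * (ind B (x.disjSum {0, 2, 3}) - ind B (xᶜ.disjSum {1}))
    + (ind A (x.disjSum univ) - ind A (xᶜ.disjSum ∅)) * (ind B (x.disjSum univ) - ind B (xᶜ.disjSum ∅))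
    + (ind A (x.disjSum {0}) - ind A (xᶜ.disjSum {0})) * (ind B (x.disjSum {1, 2, 3}) - ind B (xᶜ.disjSum {1, 2, 3}))
    + (ind A (x.disjSum {0, 2}) - ind A (xᶜ.disjSum {0, 2})) * (ind B (x.disjSum {1, 3}) - ind B (xᶜ.disjSum {1, 3}))
    + (ind A (x.disjSum {1, 2}) - ind A (xᶜ.disjSum {1, 2})) * (ind B (x.disjSum {0, 3}) - ind B (xᶜ.disjSum {0, 3}))
    + (ind A (x.disjSum {0, 3}) - ind A (xᶜ.disjSum {0, 3})) * (ind B (x.disjSum {1, 2}) - ind B (xᶜ.disjSum {1, 2}))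
    + (ind A (x.disjSum {1, 3}) - ind A (xᶜ.disjSum {1, 3})) * (ind B (x.disjSum {0, 2}) - ind B (xᶜ.disjSum {0, 2}))
    + (ind A (x.disjSum {1, 2, 3}) - ind A (xᶜ.disjSum {1, 2, 3})) * (ind B (x.disjSum {0}) - ind B (xᶜ.disjSum {0}))
    + (ind A (xᶜ.disjSum {0}) - ind A (xᶜ.disjSum {1, 2, 3})) * (ind B (xᶜ.disjSum {0}) - ind B (xᶜ.disjSum {1, 2, 3}))
    + (ind A (xᶜ.disjSum {0, 2}) - ind A (xᶜ.disjSum {1, 3})) * (ind B (xᶜ.disjSum {0, 2}) - ind B (xᶜ.disjSum {1, 3}))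
    + (ind A (xᶜ.disjSum {1, 2}) - ind A (xᶜ.disjSum {0, 3})) * (ind B (xᶜ.disjSum {1, 2}) - ind B (xᶜ.disjSum {0, 3}))

omit [Fintype γ₁] in
/-- The score row of `P₁ ∧ orCherry`. [this work] -/
theorem score_row_orCherry (A B : Finset (Finset (γ₁ ⊕ Fin 4))) (x : Finset γ₁) :
    (((orCherry ∩ refl orCherry ∩ secR B x ∩ refl (secR A x)).card : ℤ) + ((orCherry \ refl orCherry) ∩ secR A x ∩ secR B x).card)
      = ind B (x.disjSum {0}) * ind A (x.disjSum {1, 2, 3}) + ind B (x.disjSum {0, 2}) * ind A (x.disjSum {1, 3}) + ind B (x.disjSum {1, 2}) * ind A (x.disjSum {0, 3})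
        + ind B (x.disjSum {0, 3}) * ind A (x.disjSum {1, 2}) + ind B (x.disjSum {1, 3}) * ind A (x.disjSum {0, 2}) + ind B (x.disjSum {1, 2, 3}) * ind A (x.disjSum {0})
        + ind A (x.disjSum {0, 1}) * ind B (x.disjSum {0, 1}) + ind A (x.disjSum {0, 1, 2}) * ind B (x.disjSum {0, 1, 2}) + ind A (x.disjSum {0, 1, 3}) * ind B (x.disjSum {0, 1, 3})
        + ind A (x.disjSum {0, 2, 3}) * ind B (x.disjSum {0, 2, 3}) + ind A (x.disjSum univ) * ind B (x.disjSum univ) := by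
  rw [orCherry_inter_refl, orCherry_sdiff_refl, card_inter_inter_eq_sum_ind', card_inter_inter_eq_sum_ind', sum_insert (by decide), sum_insert (by decide), sum_insert (by decide), sum_insert (by decide), 
    sum_insert (by decide), sum_singleton,
    sum_insert (by decide), sum_insert (by decide), sum_insert (by decide), sum_insert (by decide), 
    sum_singleton]
  simp only [ind_refl, ind_secR, (by decide : ({0} : Finset (Fin 4))ᶜ = {1, 2, 3}), (by decide : ({0, 2} : Finset (Fin 4))ᶜ = {1, 3}), (by decide : ({1, 2} : Finset (Fin 4))ᶜ = {0, 3}), (by decide : ({0, 3} : Finset (Fin 4))ᶜ = {1, 2}), (by decide : ({1, 3} : Finset (Fin 4))ᶜ = {0, 2})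
    , (by decide : ({1, 2, 3} : Finset (Fin 4))ᶜ = {0})]
  ring

/-- First `L`-row of `P₁ ∧ orCherry`. [this work] -/
theorem lrow_orCherry₁ (A B : Finset (Finset (γ₁ ⊕ Fin 4))) (x : Finset γ₁) :
    ((orCherry ∩ secR (refl A) x ∩ secR B x).card : ℤ)
      = ind A (xᶜ.disjSum {1, 2, 3}) * ind B (x.disjSum {0}) + ind A (xᶜ.disjSum {2, 3}) * ind B (x.disjSum {0, 1}) + ind A (xᶜ.disjSum {1, 3}) * ind B (x.disjSum {0, 2})
        + ind A (xᶜ.disjSum {0, 3}) * ind B (x.disjSum {1, 2}) + ind A (xᶜ.disjSum {3}) * ind B (x.disjSum {0, 1, 2}) + ind A (xᶜ.disjSum {1, 2}) * ind B (x.disjSum {0, 3})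
        + ind A (xᶜ.disjSum {0, 2}) * ind B (x.disjSum {1, 3}) + ind A (xᶜ.disjSum {2}) * ind B (x.disjSum {0, 1, 3}) + ind A (xᶜ.disjSum {1}) * ind B (x.disjSum {0, 2, 3})
        + ind A (xᶜ.disjSum {0}) * ind B (x.disjSum {1, 2, 3}) + ind A (xᶜ.disjSum ∅) * ind B (x.disjSum univ) := by
  rw [card_inter_inter_eq_sum_ind', orCherry, sum_insert (by decide), sum_insert (by decide), sum_insert (by decide), sum_insert (by decide), 
    sum_insert (by decide), sum_insert (by decide), sum_insert (by decide), sum_insert (by decide), 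
    sum_insert (by decide), sum_insert (by decide), sum_singleton, secR_refl]
  simp only [ind_refl, ind_secR, (by decide : ({0} : Finset (Fin 4))ᶜ = {1, 2, 3}), (by decide : ({0, 1} : Finset (Fin 4))ᶜ = {2, 3}), (by decide : ({0, 2} : Finset (Fin 4))ᶜ = {1, 3}), (by decide : ({1, 2} : Finset (Fin 4))ᶜ = {0, 3}), (by decide : ({0, 1, 2} : Finset (Fin 4))ᶜ = {3})
    , (by decide : ({0, 3} : Finset (Fin 4))ᶜ = {1, 2}), (by decide : ({1, 3} : Finset (Fin 4))ᶜ = {0, 2}), (by decide : ({0, 1, 3} : Finset (Fin 4))ᶜ = {2}), (by decide : ({0, 2, 3} : Finset (Fin 4))ᶜ = {1}), (by decide : ({1, 2, 3} : Finset (Fin 4))ᶜ = {0})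
    , compl_univ]
  ring

/-- Second `L`-row of `P₁ ∧ orCherry`. [this work] -/
theorem lrow_orCherry₂ (A B : Finset (Finset (γ₁ ⊕ Fin 4))) (x : Finset γ₁) :
    ((orCherry ∩ secR A x ∩ secR (refl B) x).card : ℤ)
      = ind A (x.disjSum {0}) * ind B (xᶜ.disjSum {1, 2, 3}) + ind A (x.disjSum {0, 1}) * ind B (xᶜ.disjSum {2, 3}) + ind A (x.disjSum {0, 2}) * ind B (xᶜ.disjSum {1, 3})
        + ind A (x.disjSum {1, 2}) * ind B (xᶜ.disjSum {0, 3}) + ind A (x.disjSum {0, 1, 2}) * ind B (xᶜ.disjSum {3}) + ind A (x.disjSum {0, 3}) * ind B (xᶜ.disjSum {1, 2})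
        + ind A (x.disjSum {1, 3}) * ind B (xᶜ.disjSum {0, 2}) + ind A (x.disjSum {0, 1, 3}) * ind B (xᶜ.disjSum {2}) + ind A (x.disjSum {0, 2, 3}) * ind B (xᶜ.disjSum {1})
        + ind A (x.disjSum {1, 2, 3}) * ind B (xᶜ.disjSum {0}) + ind A (x.disjSum univ) * ind B (xᶜ.disjSum ∅) := by
  rw [card_inter_inter_eq_sum_ind', orCherry, sum_insert (by decide), sum_insert (by decide), sum_insert (by decide), sum_insert (by decide), 
    sum_insert (by decide), sum_insert (by decide), sum_insert (by decide), sum_insert (by decide), 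
    sum_insert (by decide), sum_insert (by decide), sum_singleton, secR_refl]
  simp only [ind_refl, ind_secR, (by decide : ({0} : Finset (Fin 4))ᶜ = {1, 2, 3}), (by decide : ({0, 1} : Finset (Fin 4))ᶜ = {2, 3}), (by decide : ({0, 2} : Finset (Fin 4))ᶜ = {1, 3}), (by decide : ({1, 2} : Finset (Fin 4))ᶜ = {0, 3}), (by decide : ({0, 1, 2} : Finset (Fin 4))ᶜ = {3})
    , (by decide : ({0, 3} : Finset (Fin 4))ᶜ = {1, 2}), (by decide : ({1, 3} : Finset (Fin 4))ᶜ = {0, 2}), (by decide : ({0, 1, 3} : Finset (Fin 4))ᶜ = {2}), (by decide : ({0, 2, 3} : Finset (Fin 4))ᶜ = {1}), (by decide : ({1, 2, 3} : Finset (Fin 4))ᶜ = {0})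
    , compl_univ]
  ring

/-- Third `L`-row (antipodal rows) of `P₁ ∧ orCherry`. [this work] -/
theorem lrow_orCherry₃ (A B : Finset (Finset (γ₁ ⊕ Fin 4))) (x : Finset γ₁) :
    ((refl orCherry ∩ secR A xᶜ ∩ secR B xᶜ).card : ℤ)
      = ind A (xᶜ.disjSum ∅) * ind B (xᶜ.disjSum ∅) + ind A (xᶜ.disjSum {0}) * ind B (xᶜ.disjSum {0}) + ind A (xᶜ.disjSum {1}) * ind B (xᶜ.disjSum {1})
        + ind A (xᶜ.disjSum {2}) * ind B (xᶜ.disjSum {2}) + ind A (xᶜ.disjSum {0, 2}) * ind B (xᶜ.disjSum {0, 2}) + ind A (xᶜ.disjSum {1, 2}) * ind B (xᶜ.disjSum {1, 2})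
        + ind A (xᶜ.disjSum {3}) * ind B (xᶜ.disjSum {3}) + ind A (xᶜ.disjSum {0, 3}) * ind B (xᶜ.disjSum {0, 3}) + ind A (xᶜ.disjSum {1, 3}) * ind B (xᶜ.disjSum {1, 3})
        + ind A (xᶜ.disjSum {2, 3}) * ind B (xᶜ.disjSum {2, 3}) + ind A (xᶜ.disjSum {1, 2, 3}) * ind B (xᶜ.disjSum {1, 2, 3}) := by
  rw [card_inter_inter_eq_sum_ind', refl_orCherry, sum_insert (by decide), sum_insert (by decide), sum_insert (by decide), sum_insert (by decide), 
    sum_insert (by decide), sum_insert (by decide), sum_insert (by decide), sum_insert (by decide), 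
    sum_insert (by decide), sum_insert (by decide), sum_singleton]
  simp only [ind_secR]
  ring

/-- **Row decomposition**: `Σ_B secFAScore − L_(P₁ ∧ orCherry)(A,B) = Σ_(x∈P₁) rowLow_orCherry A B x`. [this work] -/
theorem scoreVal_sub_lForm_andProd_orCherry (P₁ : Finset (Finset γ₁)) (A B : Finset (Finset (γ₁ ⊕ Fin 4))) :
    scoreVal (secFAScore P₁ orCherry) A B - lForm (andProd P₁ orCherry) A B = ∑ x ∈ P₁, rowLow_orCherry A B x := by
  rw [scoreVal_secFAScore]
  unfold lForm
  rw [card_andProd_inter_inter, card_andProd_inter_inter, refl_andProd, card_andProd_inter_inter, sum_refl_eq]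
  rw [← sum_add_distrib, ← sum_sub_distrib, ← sum_sub_distrib]
  refine sum_congr rfl fun x _ => ?_
  rw [score_row_orCherry, lrow_orCherry₁, lrow_orCherry₂, lrow_orCherry₃]
  unfold rowLow_orCherry
  ring

end FiveUpSet

end Summit.CriticalPhenomena.PercolationContinuityZ3.Theorems
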